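import Summits.AtomisticToContinuum.FouriersLaw.Theorems.BondHeatUncertaintyBoundedResponseBathHeatHeatReturnA
import HarnessLib

/-!
# BondHeatUncertainty / BoundedResponse — «HeatReturn» §3–§4: the two EXACT representations of the late functional, the HEAT-RETURN DOOR, the curve formula,
light-cone blindness and the comparison with NODE 110's energy response curves
(decomp-a2c lens-1, g111, NODE 111 «CumulativeResponse / HeatReturn»; part 2 of 3 — overview, tags and references in part 1 `…HeatReturnA`)

§3 ★ `B^late_N(s,t) = γ² ∫ (p₀² − T)·U^{s,t}_N dμ_T = γ² ∫ (k² − T)·𝔊^{s,t}_N(k) dν_T(k)` (`bathTailLate_eq_integral_kinObs_mul_lateCumFcast`,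
`bathTailLate_eq_integral_heatReturnProfile`); ★ the door `B^late_N(s,t) ≥ −γ²·𝔇_T(𝔊^{s,t}_N)` (`bathTailLate_ge_neg_heatReturnDefect`) and its `s = 0` member for the
whole bath tail; sign versions for an a.e.-energy-monotone / a.e.-convex heat-return curve.
§4 ★ `𝔊^{s,t}_N(k) = ∫_{(0,∞)} ℓ_{s,t}(u)·(Ḡ_{N,u}(k) − T) du = ∫_{(s,∞)} …` (`heatReturnProfile_eq_setIntegral`, `…_Ioi`); integrability of the integrand;
★ `heatReturnProfile_mono_of_kinKickProfile_mono`: pointwise energy-monotonicity of every `Ḡ_{N,u}`, `u > s`, gives energy-monotonicity of `𝔊^{s,t}_N` (`2s ≤ t`).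
No `sorry`, no new axioms.
-/

noncomputable section

open MeasureTheory ProbabilityTheory Filter Topology Set Function
open scoped NNReal ENNReal
open Literature.MathematicalPhysics.KineticTheory.HeatConduction
open Literature.MathematicalPhysics.KineticTheory OscillatorChain
open Literature.Probability.Process
open Summit.AtomisticToContinuum.FouriersLaw.Theorems.OddSectorIrreversibility
  (pinnedChain_stronglyMeasurable_act_uncurry pinnedChain_integral_sq_act_le_of_stronglyMeasurable
    pinnedChain_integrable_transitionKernel_of_abs_le integral_exp_neg_mul_Ioi' integrable_mul_of_integrable_sq)
open Summit.AtomisticToContinuum.FouriersLaw.Theorems.BoundedResponse.ParityFloor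
  (kinObs kinAct continuous_kinObs abs_kinObs_le stronglyMeasurable_kinAct abs_kinAct_le kinAct_integrableOn
    harrisBound_exists weight_facts kinObs_sq_facts)

namespace Summit.AtomisticToContinuum.FouriersLaw.Theorems.BoundedResponse.HeatSpreading

/-! ## §3 Two EXACT representations of the late functional: microstate (`θ₀·U`) and 1-D thermal (`θ_T·𝔊`); the heat-return door -/

/-- `K_{n+1}(u) = ⟨θ₀, P_u θ₀⟩_{μ_T}` in the `kinObs`/`kinAct` vocabulary. [formal bookkeeping] -/
theorem bathKinCorr_succ_eq_integral_kinObs_mul_kinAct (ω₂ lam β γ T : ℝ) (n : ℕ) (u : ℝ) :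
    bathKinCorr ω₂ lam β γ T (n + 1) u =
      ∫ z, kinObs T (n + 1) 0 z * kinAct ω₂ lam β γ T (n + 1) 0 u z ∂((pinnedChain ω₂ lam β γ).gibbsMeasure (n + 1) T) := by
  unfold bathKinCorr
  rw [dif_pos (Nat.succ_pos n)]
  rfl

/-- `B_N(0) = 0`. [formal bookkeeping] -/
theorem bathTail_zero (ω₂ lam β γ T : ℝ) (N : ℕ) : bathTail ω₂ lam β γ T N 0 = 0 := by
  unfold bathTail
  rw [setIntegral_congr_fun measurableSet_Ioi (fun r hr => by
    simp only [min_eq_right (le_of_lt (show (0:ℝ) < r from hr)), zero_mul] : EqOn (fun r : ℝ => min r 0 * bathKinCorr ω₂ lam β γ T N r)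
      (fun _ => 0) (Ioi (0:ℝ))), integral_zero, mul_zero]

/-- `B^late_N(0, t) = B_N(t)`: with no blind window the late functional is the whole bath tail (`ℓ_{0,t} = min(·,t)`). [formal bookkeeping] -/
theorem bathTailLate_zero_left (ω₂ lam β γ T : ℝ) (N : ℕ) (t : ℝ) :
    bathTailLate ω₂ lam β γ T N 0 t = bathTail ω₂ lam β γ T N t := by
  unfold bathTailLate bathTailEarly
  rw [mul_zero, bathTail_zero]
  ring

/-- The even symmetrisation of a convex curve is convex and nondecreasing in `k²`. [formal bookkeeping] -/
theorem monotoneSq_symm_of_convexOn {R : ℝ → ℝ} (hconv : ConvexOn ℝ Set.univ R) (k₁ k₂ : ℝ) (h : k₁ ^ 2 ≤ k₂ ^ 2) :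
    (R k₁ + R (-k₁)) / 2 ≤ (R k₂ + R (-k₂)) / 2 := by
  have hR' : ConvexOn ℝ Set.univ (fun k => (R k + R (-k)) / 2) := by
    refine ⟨convex_univ, fun x _ y _ a' b' ha hb hab => ?_⟩
    have h1 := hconv.2 (mem_univ x) (mem_univ y) ha hb hab
    have h2 := hconv.2 (mem_univ (-x)) (mem_univ (-y)) ha hb hab
    simp only [smul_eq_mul] at h1 h2 ⊢
    have e : -(a' * x + b' * y) = a' * -x + b' * -y := by ring
    rw [e]
    linarith
  exact monotoneSq_of_convexOn_even hR' (fun k => by simp only [neg_neg]; ring) k₁ k₂ h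

section Representation

variable {ω₂ lam β γ : ℝ} {T : ℝ} (hω : 0 < ω₂) (hl : 0 < lam) (hβ : 0 < β) (hγ : 0 < γ) (hT : 0 < T)
include hω hl hβ hγ hT

/-- ★★ **MICROSTATE REPRESENTATION** `B^late_N(s,t) = γ² ∫ θ₀·U^{s,t}_N dμ_T` (`N = n+1`, `s, t ≥ 0`): the late functional of NODE 109 is ONE
equilibrium correlation — initial boundary heat × late-weighted cumulative forecast (weighted Fubini, §1). [this cell] -/
theorem bathTailLate_eq_integral_kinObs_mul_lateCumFcast (n : ℕ) {s t : ℝ} (hs : 0 ≤ s) (ht : 0 ≤ t) :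
    bathTailLate ω₂ lam β γ T (n + 1) s t =
      γ ^ 2 * ∫ z : PhaseSpace (n + 1), (z.2 0 ^ 2 - T) * lateCumFcast ω₂ lam β γ T (n + 1) s t z
        ∂((pinnedChain ω₂ lam β γ).gibbsMeasure (n + 1) T) := by
  rw [bathTailLate_eq_integral hω hl hβ hγ hT (Nat.succ_pos n) hs ht]
  congr 1
  simp_rw [bathKinCorr_succ_eq_integral_kinObs_mul_kinAct]
  obtain ⟨hϑ0, h2ϑ, hϑ1⟩ := weight_facts hT
  obtain ⟨K, c, hK0, hc, hb⟩ := harrisBound_exists hω hl.le hβ hγ (Nat.succ_pos n) hT hϑ0 hϑ1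
  haveI := pinnedChain_isProbabilityMeasure_gibbsMeasure hω hl.le hβ.le γ (n + 1) hT
  have hν := pinnedChain_integrable_exp_mul_hamiltonian_gibbsMeasure hω hl.le hβ.le γ (n + 1) hT h2ϑ
  obtain ⟨hθm, hθ2⟩ := kinObs_sq_facts hω hl.le hβ hγ (Nat.succ_pos n) hT (0 : Fin (n + 1))
  have h := integral_mul_setIntegral_weight_kinAct hω hl.le hβ.le hγ.le hT hϑ0 hK0.le hb hc 0 _ hν hθm hθ2
    (continuous_lateWeight s t).measurable (fun u hu => abs_lateWeight_le s t hu.le)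
  rw [← h]
  refine integral_congr_ae (ae_of_all _ fun z => ?_)
  beta_reduce
  rw [lateCumFcast_succ]
  rfl

/-- ★★ **1-D THERMAL REPRESENTATION** `B^late_N(s,t) = γ² ∫ (k² − T)·𝔊^{s,t}_N(k) dν_T(k)`, with `θ_T·𝔊^{s,t}_N ∈ L¹(ν_T)` (Gaussian
disintegration of `p₀` under `μ_T`, NODE 110 `integral_kinObs_mul_eq_kickAvg`). [this cell] -/
theorem bathTailLate_eq_integral_heatReturnProfile (n : ℕ) {s t : ℝ} (hs : 0 ≤ s) (ht : 0 ≤ t) :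
    Integrable (fun k : ℝ => (k ^ 2 - T) * heatReturnProfile ω₂ lam β γ T (n + 1) s t k) (gaussianReal 0 T.toNNReal) ∧
      bathTailLate ω₂ lam β γ T (n + 1) s t =
        γ ^ 2 * ∫ k, (k ^ 2 - T) * heatReturnProfile ω₂ lam β γ T (n + 1) s t k ∂(gaussianReal 0 T.toNNReal) := by
  rw [heatReturnProfile_succ, bathTailLate_eq_integral_kinObs_mul_lateCumFcast hω hl hβ hγ hT n hs ht]
  have h := integral_kinObs_mul_eq_kickAvg hω hl.le hβ.le hT
    (stronglyMeasurable_lateCumFcast hω hl.le hβ.le hγ.le T n s t).measurable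
    (lateCumFcast_sq_facts hω hl.le hβ hγ hT n s t).2
  exact ⟨h.1, by rw [h.2]⟩

/-- ★★ **THE HEAT-RETURN DOOR, pointwise in `(N, s, t)`**: `B^late_N(s,t) ≥ −γ²·𝔇_T(𝔊^{s,t}_N)` — the late functional is floored by the
crossing defect (NODE 110 `thermalCrossDefect`) of ONE curve. [this cell] -/
theorem bathTailLate_ge_neg_heatReturnDefect (n : ℕ) {s t : ℝ} (hs : 0 ≤ s) (ht : 0 ≤ t) :
    -(γ ^ 2 * thermalCrossDefect T (heatReturnProfile ω₂ lam β γ T (n + 1) s t)) ≤ bathTailLate ω₂ lam β γ T (n + 1) s t := by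
  obtain ⟨hI, e⟩ := bathTailLate_eq_integral_heatReturnProfile hω hl hβ hγ hT n hs ht
  rw [e, ← mul_neg]
  exact mul_le_mul_of_nonneg_left (integral_sqSub_mul_ge_neg_thermalCrossDefect hT.le hI) (sq_nonneg γ)

/-- ★ The WHOLE bath tail has a heat-return door too (`s = 0`, weight `min(·, t)`): `B_N(t) ≥ −γ²·𝔇_T(𝔊^{0,t}_N)` — a door into
`BathTailFloor g` itself. [this cell] -/
theorem bathTail_ge_neg_heatReturnDefect (n : ℕ) {t : ℝ} (ht : 0 ≤ t) :
    -(γ ^ 2 * thermalCrossDefect T (heatReturnProfile ω₂ lam β γ T (n + 1) 0 t)) ≤ bathTail ω₂ lam β γ T (n + 1) t := by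
  rw [← bathTailLate_zero_left]
  exact bathTailLate_ge_neg_heatReturnDefect hω hl hβ hγ hT n le_rfl ht

/-- ★ **Sign version**: a heat-return curve `ν_T`-a.e. equal to a curve NONDECREASING IN THE INJECTED ENERGY gives `B^late_N(s,t) ≥ 0`
(«a harder kick never returns LESS late-time-weighted heat to the boundary»). [this cell] -/
theorem bathTailLate_nonneg_of_monotoneSq (n : ℕ) {s t : ℝ} (hs : 0 ≤ s) (ht : 0 ≤ t) {R : ℝ → ℝ}
    (hmono : ∀ k₁ k₂ : ℝ, k₁ ^ 2 ≤ k₂ ^ 2 → R k₁ ≤ R k₂)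
    (hae : heatReturnProfile ω₂ lam β γ T (n + 1) s t =ᵐ[gaussianReal 0 T.toNNReal] R) :
    0 ≤ bathTailLate ω₂ lam β γ T (n + 1) s t := by
  obtain ⟨hI, -⟩ := bathTailLate_eq_integral_heatReturnProfile hω hl hβ hγ hT n hs ht
  have h := bathTailLate_ge_neg_heatReturnDefect hω hl hβ hγ hT n hs ht
  rw [thermalCrossDefect_eq_zero_of_ae_monotoneSq hT.le hI hmono hae, mul_zero, neg_zero] at h
  exact h

omit hl hβ hγ hT in
/-- The even symmetrisation of an a.e.-representative is again an a.e.-representative (the curve is even, `ν_T` is flip-invariant).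
[formal bookkeeping] -/
theorem heatReturnProfile_ae_eq_symm (hl : 0 ≤ lam) (hβ : 0 ≤ β) (hγ : 0 ≤ γ) (N : ℕ) (s t : ℝ) {R : ℝ → ℝ}
    (hae : heatReturnProfile ω₂ lam β γ T N s t =ᵐ[gaussianReal 0 T.toNNReal] R) :
    heatReturnProfile ω₂ lam β γ T N s t =ᵐ[gaussianReal 0 T.toNNReal] fun k => (R k + R (-k)) / 2 := by
  have heven : ∀ k, heatReturnProfile ω₂ lam β γ T N s t (-k) = heatReturnProfile ω₂ lam β γ T N s t k :=
    fun k => heatReturnProfile_neg hω hl hβ hγ T N s t k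
  have h2 : (fun k => heatReturnProfile ω₂ lam β γ T N s t (-k)) =ᵐ[gaussianReal 0 T.toNNReal] (fun k => R (-k)) :=
    hae.comp_tendsto (gaussT_measurePreserving_neg T).quasiMeasurePreserving.tendsto_ae
  filter_upwards [hae, h2] with k hk hk2
  simp only [heven] at hk2
  simp only [← hk, ← hk2]
  ring

/-- ★ **KICK-CONVEXITY version**: a heat-return curve `ν_T`-a.e. equal to a CONVEX curve gives `B^late_N(s,t) ≥ 0` (evenness ⟹ the symmetrisation
is convex and even ⟹ nondecreasing in `k²`). [this cell] -/
theorem bathTailLate_nonneg_of_convexOn (n : ℕ) {s t : ℝ} (hs : 0 ≤ s) (ht : 0 ≤ t) {R : ℝ → ℝ}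
    (hconv : ConvexOn ℝ Set.univ R) (hae : heatReturnProfile ω₂ lam β γ T (n + 1) s t =ᵐ[gaussianReal 0 T.toNNReal] R) :
    0 ≤ bathTailLate ω₂ lam β γ T (n + 1) s t :=
  bathTailLate_nonneg_of_monotoneSq hω hl hβ hγ hT n hs ht (monotoneSq_symm_of_convexOn hconv)
    (heatReturnProfile_ae_eq_symm hω hl.le hβ.le hγ.le (n + 1) s t hae)

end Representation

/-! ## §4 The heat-return curve = the ℓ-weighted time integral of the energy response curve; light-cone blindness; comparison with (ER↑) -/

/-- Along the kick the Boltzmann weight changes by a bounded factor: `e^{θH(q, p[0 ↦ k])} ≤ e^{θk²/2}·e^{θH(q,p)}` (`θ ≥ 0`). [folklore] -/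
theorem exp_mul_hamiltonian_kick_le (P : OscillatorChain) {n : ℕ} {θ : ℝ} (hθ : 0 ≤ θ) (z : PhaseSpace (n + 1)) (k : ℝ) :
    Real.exp (θ * P.hamiltonian (n + 1) ((z.1, Function.update z.2 0 k) : PhaseSpace (n + 1))) ≤
      Real.exp (θ * (k ^ 2 / 2)) * Real.exp (θ * P.hamiltonian (n + 1) z) := by
  rw [← Real.exp_add, hamiltonian_kick_eq]
  refine Real.exp_le_exp.2 ?_
  nlinarith [mul_nonneg hθ (sq_nonneg (z.2 0))]

/-- `𝔊` as an integral over the kick pushforward `(q, p[0 ↦ k])_* μ_T`. [formal bookkeeping] -/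
theorem integral_kick_eq_integral_map (ω₂ lam β γ T : ℝ) {n : ℕ} (g : PhaseSpace (n + 1) → ℝ) (hg : StronglyMeasurable g) (k : ℝ) :
    ∫ z : PhaseSpace (n + 1), g ((z.1, Function.update z.2 0 k) : PhaseSpace (n + 1)) ∂((pinnedChain ω₂ lam β γ).gibbsMeasure (n + 1) T) =
      ∫ y, g y ∂(((pinnedChain ω₂ lam β γ).gibbsMeasure (n + 1) T).map
        (fun z : PhaseSpace (n + 1) => ((z.1, Function.update z.2 0 k) : PhaseSpace (n + 1)))) :=
  (integral_map (measurable_kickMomentum n k).aemeasurable hg.aestronglyMeasurable).symm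

section ProfileFormula

variable {ω₂ lam β γ : ℝ} {T : ℝ} (hω : 0 < ω₂) (hl : 0 < lam) (hβ : 0 < β) (hγ : 0 < γ) (hT : 0 < T)
include hω hl hβ hγ hT

omit hγ in
/-- **Integrability along the kick**: for strongly measurable `g` with `|g| ≤ C e^{ϑH}` (`0 ≤ ϑ < 1/T`), `z ↦ g(q, p[0 ↦ k]) ∈ L¹(μ_T)` and
`∫ |g(q, p[0 ↦ k])| dμ_T ≤ C·e^{ϑk²/2}·∫ e^{ϑH} dμ_T`. [folklore] -/
theorem integrable_kick_of_abs_le {n : ℕ} {ϑ C : ℝ} (hϑ0 : 0 ≤ ϑ) (hϑ1 : ϑ < 1 / T) {g : PhaseSpace (n + 1) → ℝ}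
    (hgm : StronglyMeasurable g) (hgb : ∀ y, |g y| ≤ C * Real.exp (ϑ * (pinnedChain ω₂ lam β γ).hamiltonian (n + 1) y)) (k : ℝ) :
    Integrable (fun z : PhaseSpace (n + 1) => g ((z.1, Function.update z.2 0 k) : PhaseSpace (n + 1)))
      ((pinnedChain ω₂ lam β γ).gibbsMeasure (n + 1) T) ∧
    ∫ z : PhaseSpace (n + 1), |g ((z.1, Function.update z.2 0 k) : PhaseSpace (n + 1))| ∂((pinnedChain ω₂ lam β γ).gibbsMeasure (n + 1) T) ≤
      C * Real.exp (ϑ * (k ^ 2 / 2)) *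
        ∫ z, Real.exp (ϑ * (pinnedChain ω₂ lam β γ).hamiltonian (n + 1) z) ∂((pinnedChain ω₂ lam β γ).gibbsMeasure (n + 1) T) := by
  have hμ1 := pinnedChain_integrable_exp_mul_hamiltonian_gibbsMeasure hω hl.le hβ.le γ (n + 1) hT hϑ1
  have hdom : Integrable (fun z => C * Real.exp (ϑ * (k ^ 2 / 2)) * Real.exp (ϑ * (pinnedChain ω₂ lam β γ).hamiltonian (n + 1) z))
      ((pinnedChain ω₂ lam β γ).gibbsMeasure (n + 1) T) := hμ1.const_mul _
  have hm : AEStronglyMeasurable (fun z : PhaseSpace (n + 1) => g ((z.1, Function.update z.2 0 k) : PhaseSpace (n + 1)))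
      ((pinnedChain ω₂ lam β γ).gibbsMeasure (n + 1) T) :=
    (hgm.measurable.comp (measurable_kickMomentum n k)).aestronglyMeasurable
  have hpt : ∀ z : PhaseSpace (n + 1), |g ((z.1, Function.update z.2 0 k) : PhaseSpace (n + 1))| ≤
      C * Real.exp (ϑ * (k ^ 2 / 2)) * Real.exp (ϑ * (pinnedChain ω₂ lam β γ).hamiltonian (n + 1) z) := fun z => by
    refine (hgb _).trans ?_
    have hC : 0 ≤ C := (mul_nonneg_iff_of_pos_right (Real.exp_pos _)).1 ((abs_nonneg _).trans (hgb z))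
    rw [mul_assoc]
    exact mul_le_mul_of_nonneg_left (exp_mul_hamiltonian_kick_le _ hϑ0 z k) hC
  refine ⟨hdom.mono' hm (Eventually.of_forall fun z => by rw [Real.norm_eq_abs]; exact hpt z), ?_⟩
  calc ∫ z : PhaseSpace (n + 1), |g ((z.1, Function.update z.2 0 k) : PhaseSpace (n + 1))|
        ∂((pinnedChain ω₂ lam β γ).gibbsMeasure (n + 1) T)
      ≤ ∫ z, C * Real.exp (ϑ * (k ^ 2 / 2)) * Real.exp (ϑ * (pinnedChain ω₂ lam β γ).hamiltonian (n + 1) z)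
          ∂((pinnedChain ω₂ lam β γ).gibbsMeasure (n + 1) T) :=
        integral_mono_of_nonneg (ae_of_all _ fun z => abs_nonneg _) hdom (ae_of_all _ hpt)
    _ = _ := integral_const_mul _ _

/-- ★ **The kick average of the propagated boundary heat is the centred energy response curve**: `∫ v_u(q, p[0 ↦ k]) dμ_T = Ḡ_{N,u}(k) − T`
(`v_u = P_u(p₀² − T)`, `P_u(z,·)` a probability). [this cell] -/
theorem kickAvg_kinAct_eq (n : ℕ) (u k : ℝ) :
    kickAvg ω₂ lam β γ T n (kinAct ω₂ lam β γ T (n + 1) 0 u) k = kinKickProfile ω₂ lam β γ T (n + 1) u k - T := by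
  obtain ⟨hϑ0, -, hϑ1⟩ := weight_facts hT
  set ϑ : ℝ := 1 / (4 * T) with hϑ
  obtain ⟨K, c, hK0, hc, hb⟩ := harrisBound_exists hω hl.le hβ hγ (Nat.succ_pos n) hT hϑ0 hϑ1
  haveI := pinnedChain_isProbabilityMeasure_gibbsMeasure hω hl.le hβ.le γ (n + 1) hT
  have hpt : ∀ x : PhaseSpace (n + 1),
      (∫ y, y.2 0 ^ 2 ∂((pinnedChain ω₂ lam β γ).transitionKernel (n + 1) T T u.toNNReal x)) =
        kinAct ω₂ lam β γ T (n + 1) 0 u x + T := fun x => by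
    haveI := pinnedChain_isMarkovKernel_transitionKernel hω hl.le hβ.le hγ.le (n + 1) T T u.toNNReal
    have hi : Integrable (kinObs T (n + 1) 0) ((pinnedChain ω₂ lam β γ).transitionKernel (n + 1) T T u.toNNReal x) :=
      pinnedChain_integrable_transitionKernel_of_abs_le hω hl.le (Nat.succ_pos n) hT hβ.le hγ.le hϑ0 hϑ1
        (continuous_kinObs T 0) (fun y => abs_kinObs_le hω hl.le hβ.le hT.le hϑ0 0 y) u.toNNReal x
    have e : (fun y : PhaseSpace (n + 1) => y.2 0 ^ 2) = fun y => kinObs T (n + 1) 0 y + T := by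
      funext y; simp only [kinObs]; ring
    unfold kinAct
    rw [e, integral_add hi (integrable_const T), integral_const, probReal_univ, one_smul]
  have hA := (integrable_kick_of_abs_le hω hl hβ hT hϑ0.le hϑ1 (stronglyMeasurable_kinAct ω₂ lam β γ T 0 u)
    (C := K * (2 / ϑ + T) * Real.exp (-c * (u.toNNReal : ℝ)))
    (fun y => (abs_kinAct_le hω hl.le hβ.le hT hϑ0 hb 0 u y).trans_eq (by ring)) k).1
  rw [kinKickProfile_succ]
  unfold kickAvg
  simp_rw [hpt]
  rw [integral_add hA (integrable_const T), integral_const, probReal_univ, one_smul]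
  ring

/-- ★★ **THE HEAT-RETURN CURVE IS THE ℓ-WEIGHTED TIME INTEGRAL OF THE ENERGY RESPONSE CURVE**:
`𝔊^{s,t}_N(k) = ∫_{(0,∞)} ℓ_{s,t}(u)·(Ḡ_{N,u}(k) − T) du` for EVERY `k` (weighted Fubini on the kick pushforward; `Ḡ` = NODE 110 `kinKickProfile`,
the census KICK profile `ĝ_u(k)`). [this cell] -/
theorem heatReturnProfile_eq_setIntegral (n : ℕ) (s t k : ℝ) :
    heatReturnProfile ω₂ lam β γ T (n + 1) s t k =
      ∫ u in Ioi (0 : ℝ), lateWeight s t u * (kinKickProfile ω₂ lam β γ T (n + 1) u k - T) := by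
  obtain ⟨hϑ0, h2ϑ, hϑ1⟩ := weight_facts hT
  set ϑ : ℝ := 1 / (4 * T) with hϑ
  obtain ⟨K, c, hK0, hc, hb⟩ := harrisBound_exists hω hl.le hβ hγ (Nat.succ_pos n) hT hϑ0 hϑ1
  haveI : IsProbabilityMeasure ((pinnedChain ω₂ lam β γ).gibbsMeasure (n + 1) T) :=
    pinnedChain_isProbabilityMeasure_gibbsMeasure hω hl.le hβ.le γ (n + 1) hT
  have hφ := measurable_kickMomentum n k
  haveI : IsProbabilityMeasure (((pinnedChain ω₂ lam β γ).gibbsMeasure (n + 1) T).map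
      (fun z : PhaseSpace (n + 1) => ((z.1, Function.update z.2 0 k) : PhaseSpace (n + 1)))) :=
    Measure.isProbabilityMeasure_map hφ.aemeasurable
  -- the kick pushforward integrates `e^{2ϑH}`
  have h2ϑ0 : 0 ≤ 2 * ϑ := by positivity
  have hcontE : Continuous fun y : PhaseSpace (n + 1) => Real.exp (2 * ϑ * (pinnedChain ω₂ lam β γ).hamiltonian (n + 1) y) :=
    Real.continuous_exp.comp (continuous_const.mul (pinnedChain_continuous_hamiltonian ω₂ lam β γ (n + 1)))
  have hν2 : Integrable (fun y => Real.exp (2 * ϑ * (pinnedChain ω₂ lam β γ).hamiltonian (n + 1) y))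
      (((pinnedChain ω₂ lam β γ).gibbsMeasure (n + 1) T).map
        (fun z : PhaseSpace (n + 1) => ((z.1, Function.update z.2 0 k) : PhaseSpace (n + 1)))) := by
    rw [integrable_map_measure hcontE.aestronglyMeasurable hφ.aemeasurable]
    exact (integrable_kick_of_abs_le hω hl hβ hT h2ϑ0 h2ϑ hcontE.stronglyMeasurable (C := 1)
      (fun y => by rw [abs_of_pos (Real.exp_pos _), one_mul]) k).1
  -- weighted Fubini on the pushforward with `F ≡ 1`
  have hF := integral_mul_setIntegral_weight_kinAct hω hl.le hβ.le hγ.le hT hϑ0 hK0.le hb hc 0 _ hν2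
    stronglyMeasurable_const (F := fun _ => (1 : ℝ)) (by simp only [one_pow]; exact integrable_const 1)
    (continuous_lateWeight s t).measurable (fun u hu => abs_lateWeight_le s t hu.le)
  simp only [one_mul] at hF
  rw [heatReturnProfile_succ]
  unfold kickAvg
  rw [integral_kick_eq_integral_map ω₂ lam β γ T (lateCumFcast ω₂ lam β γ T (n + 1) s t)
    (stronglyMeasurable_lateCumFcast hω hl.le hβ.le hγ.le T n s t) k]
  simp_rw [lateCumFcast_succ]
  rw [hF]
  refine setIntegral_congr_fun measurableSet_Ioi (fun u _ => ?_)
  show lateWeight s t u * _ = lateWeight s t u * _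
  congr 1
  rw [← kickAvg_kinAct_eq hω hl hβ hγ hT n u k]
  unfold kickAvg
  exact (integral_kick_eq_integral_map ω₂ lam β γ T (kinAct ω₂ lam β γ T (n + 1) 0 u)
    (stronglyMeasurable_kinAct ω₂ lam β γ T 0 u) k).symm

/-- ★★ **LIGHT-CONE BLINDNESS OF THE CURVE**: for `0 ≤ s ≤ t`, `𝔊^{s,t}_N(k) = ∫_{(s,∞)} ℓ_{s,t}(u)·(Ḡ_{N,u}(k) − T) du` — the heat-return curve
does not see the energy response at ANY lag `u ≤ s` (`ℓ_{s,t} ≡ 0` there, NODE 109). [this cell] -/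
theorem heatReturnProfile_eq_setIntegral_Ioi (n : ℕ) {s t : ℝ} (hs : 0 ≤ s) (hst : s ≤ t) (k : ℝ) :
    heatReturnProfile ω₂ lam β γ T (n + 1) s t k =
      ∫ u in Ioi s, lateWeight s t u * (kinKickProfile ω₂ lam β γ T (n + 1) u k - T) := by
  rw [heatReturnProfile_eq_setIntegral hω hl hβ hγ hT n s t k]
  refine setIntegral_eq_of_subset_of_forall_sdiff_eq_zero measurableSet_Ioi (Ioi_subset_Ioi hs) (fun u hu => ?_)
  have hus : u ≤ s := not_lt.1 hu.2
  rw [lateWeight_eq_zero hs hus (hus.trans hst), zero_mul]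

/-- `u ↦ Ḡ_{N,u}(k) − T` is measurable and dominated: `|Ḡ_{N,u}(k) − T| ≤ K(2/ϑ+T)·e^{ϑk²/2}·(∫e^{ϑH}dμ_T)·e^{−cu}` for `u ≥ 0`; hence
`ℓ_{s,t}·(Ḡ_{N,·}(k) − T) ∈ L¹((0,∞))`. [folklore] -/
theorem integrableOn_lateWeight_mul_kinKickProfile_sub (n : ℕ) (s t k : ℝ) :
    IntegrableOn (fun u : ℝ => lateWeight s t u * (kinKickProfile ω₂ lam β γ T (n + 1) u k - T)) (Ioi 0) := by
  obtain ⟨hϑ0, -, hϑ1⟩ := weight_facts hT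
  set ϑ : ℝ := 1 / (4 * T) with hϑ
  haveI := pinnedChain_isProbabilityMeasure_gibbsMeasure hω hl.le hβ.le γ (n + 1) hT
  obtain ⟨K, c, hK0, hc, hb⟩ := harrisBound_exists hω hl.le hβ hγ (Nat.succ_pos n) hT hϑ0 hϑ1
  -- measurability of `u ↦ Ḡ_{N,u}(k) − T = ∫ v_u(q, p[0 ↦ k]) dμ_T`
  have hrepr : ∀ u : ℝ, kinKickProfile ω₂ lam β γ T (n + 1) u k - T =
      ∫ z : PhaseSpace (n + 1), kinAct ω₂ lam β γ T (n + 1) 0 u ((z.1, Function.update z.2 0 k) : PhaseSpace (n + 1))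
        ∂((pinnedChain ω₂ lam β γ).gibbsMeasure (n + 1) T) := fun u => by
    rw [← kickAvg_kinAct_eq hω hl hβ hγ hT n u k]; rfl
  have h1 := (pinnedChain_stronglyMeasurable_act_uncurry hω hl.le hβ.le hγ.le T T (N := n + 1)
    (continuous_kinObs T (0 : Fin (n + 1))).measurable).comp_measurable
    (measurable_fst.prodMk ((measurable_kickMomentum n k).comp measurable_snd) :
      Measurable fun q : ℝ × PhaseSpace (n + 1) => (q.1, ((q.2.1, Function.update q.2.2 0 k) : PhaseSpace (n + 1))))
  have hGm : StronglyMeasurable fun u : ℝ => kinKickProfile ω₂ lam β γ T (n + 1) u k - T := by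
    have h3 := StronglyMeasurable.integral_prod_right' (ν := (pinnedChain ω₂ lam β γ).gibbsMeasure (n + 1) T) h1
    have e : (fun u : ℝ => kinKickProfile ω₂ lam β γ T (n + 1) u k - T) = fun u : ℝ =>
        ∫ z : PhaseSpace (n + 1), ((fun q : ℝ × PhaseSpace (n + 1) =>
          ∫ y, kinObs T (n + 1) 0 y ∂((pinnedChain ω₂ lam β γ).transitionKernel (n + 1) T T q.1.toNNReal q.2)) ∘
          (fun q : ℝ × PhaseSpace (n + 1) => (q.1, ((q.2.1, Function.update q.2.2 0 k) : PhaseSpace (n + 1))))) (u, z)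
          ∂((pinnedChain ω₂ lam β γ).gibbsMeasure (n + 1) T) := by
      funext u
      rw [hrepr u]
      rfl
    rw [e]
    exact h3
  set I := ∫ z, Real.exp (ϑ * (pinnedChain ω₂ lam β γ).hamiltonian (n + 1) z) ∂((pinnedChain ω₂ lam β γ).gibbsMeasure (n + 1) T) with hI
  set M := (|t| + 4 * |s|) * (K * (2 / ϑ + T) * Real.exp (ϑ * (k ^ 2 / 2)) * I) with hM
  have hdecay : IntegrableOn (fun u : ℝ => M * Real.exp (-c * u)) (Ioi 0) := (exp_neg_integrableOn_Ioi 0 hc).const_mul _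
  refine hdecay.mono' (((continuous_lateWeight s t).measurable.stronglyMeasurable.mul hGm).aestronglyMeasurable.restrict) ?_
  refine (ae_restrict_iff' measurableSet_Ioi).2 (Eventually.of_forall fun u hu => ?_)
  have hu0 : 0 ≤ u := le_of_lt (show (0:ℝ) < u from hu)
  rw [norm_mul, Real.norm_eq_abs, Real.norm_eq_abs, hrepr u]
  have hkick := (integrable_kick_of_abs_le hω hl hβ hT hϑ0.le hϑ1 (stronglyMeasurable_kinAct ω₂ lam β γ T 0 u)
    (C := K * (2 / ϑ + T) * Real.exp (-c * (u.toNNReal : ℝ)))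
    (fun y => (abs_kinAct_le hω hl.le hβ.le hT hϑ0 hb 0 u y).trans_eq (by ring)) k).2
  rw [Real.coe_toNNReal _ hu0] at hkick
  have hW := abs_lateWeight_le s t hu0
  have hI0 : 0 ≤ I := integral_nonneg fun z => (Real.exp_pos _).le
  calc |lateWeight s t u| * |∫ z : PhaseSpace (n + 1), kinAct ω₂ lam β γ T (n + 1) 0 u ((z.1, Function.update z.2 0 k) : PhaseSpace (n + 1))
          ∂((pinnedChain ω₂ lam β γ).gibbsMeasure (n + 1) T)|
      ≤ (|t| + 4 * |s|) * (K * (2 / ϑ + T) * Real.exp (-c * u) * Real.exp (ϑ * (k ^ 2 / 2)) * I) :=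
        mul_le_mul hW ((abs_integral_le_integral_abs).trans hkick) (abs_nonneg _) ((abs_nonneg _).trans hW)
    _ = M * Real.exp (-c * u) := by rw [hM]; ring

/-- ★★ **COMPARISON WITH NODE 110**: if past the blind window (`u > s`) every energy response curve `Ḡ_{N,u}` is nondecreasing in the injected
energy, then so is the heat-return curve `𝔊^{s,t}_N` (`0 ≤ s`, `2s ≤ t`, so that `ℓ_{s,t} ≥ 0`): ECHO TIMING IS IRRELEVANT — (HR↑) only asks that MORE
late-time-weighted heat come back after a harder kick, not that it come back at every single lag. [this cell] -/
theorem heatReturnProfile_mono_of_kinKickProfile_mono (n : ℕ) {s t : ℝ} (hs : 0 ≤ s) (hst : 2 * s ≤ t)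
    (hmono : ∀ u : ℝ, s < u → ∀ k₁ k₂ : ℝ, k₁ ^ 2 ≤ k₂ ^ 2 →
      kinKickProfile ω₂ lam β γ T (n + 1) u k₁ ≤ kinKickProfile ω₂ lam β γ T (n + 1) u k₂)
    (k₁ k₂ : ℝ) (hk : k₁ ^ 2 ≤ k₂ ^ 2) :
    heatReturnProfile ω₂ lam β γ T (n + 1) s t k₁ ≤ heatReturnProfile ω₂ lam β γ T (n + 1) s t k₂ := by
  have hst' : s ≤ t := by linarith
  rw [heatReturnProfile_eq_setIntegral_Ioi hω hl hβ hγ hT n hs hst' k₁, heatReturnProfile_eq_setIntegral_Ioi hω hl hβ hγ hT n hs hst' k₂]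
  have hI := fun k => (integrableOn_lateWeight_mul_kinKickProfile_sub hω hl hβ hγ hT n s t k).mono_set (Ioi_subset_Ioi hs)
  refine setIntegral_mono_on (hI k₁) (hI k₂) measurableSet_Ioi (fun u hu => ?_)
  exact mul_le_mul_of_nonneg_left (sub_le_sub_right (hmono u hu k₁ k₂ hk) T)
    (lateWeight_nonneg hs hst (hs.trans (le_of_lt (show s < u from hu))))

end ProfileFormula

end Summit.AtomisticToContinuum.FouriersLaw.Theorems.BoundedResponse.HeatSpreading

end
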